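import Summits.FinalStateConjecture.FinalStateConjecture.Theses.ZeroEnergyKerrOrBomb
import Literature.Geometry.Lorentzian.IdealPoints
import Literature.Geometry.Lorentzian.StationaryBlackHoleUniquenessProofs
import Literature.Geometry.Lorentzian.StaticBlackHoleUniquenessProofs
import Literature.Geometry.Lorentzian.CausalityPushUp
import Literature.Geometry.Lorentzian.CauchyHypersurfaceGlobalHyperbolicity
import Literature.Geometry.Lorentzian.CausalityOpennessProofs
import Literature.Geometry.Lorentzian.AFEndRestrict
import Literature.Geometry.Lorentzian.AFEndTransport
import Literature.Geometry.Lorentzian.ModelData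
import Literature.Geometry.Lorentzian.InitialDataLocality

/-!
# `ZeroEnergyRigidity`, line `global-horizon-killing-field` — stub `stub_futurePresentation`,
# part C: the two pieces of `𝓑` entering the re-presentation — the sub-carrier `I⁺(M_ext)` and
# the far piece `Σ_ext' = e.far (R + 1)` of the slice

Support file for crux `stmt-FinalStateConjecture-10690`
(`Summit.FinalStateConjecture.FinalStateConjecture.Theses.ZeroEnergyKerrOrBomb.ZeroEnergyRigidity`),
stub S1b `stub_futurePresentation` (WLOG the carrier of a presentation is `I⁺(M_ext)`):

* push-up: `I⁺(S)` is a future set which no causal curve leaves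
  (`forall_mem_chronologicalFuture_of_isFutureCausalCurveOn`, from the tree's
  `mem_chronologicalFuture_of_mem_chronologicalFuture_of_mem_causalFuture_set`, O'Neill's
  Cor. 14.1), and `I⁺(A)` is preconnected when `A ⊆ I⁺(A)` is
  (`isPreconnected_chronologicalFuture`);
* the sub-carrier `V = I⁺(M_ext)` of a presentation `𝓑`: open, invariant under the stationary
  flow, connected, left by no causal curve; and **`I^±(M₂) = I^±(M_ext)` for every non-empty
  flow-invariant `M₂ ⊆ M_ext`** (`chronologicalFuture_eq_of_invariant`,
  `chronologicalPast_eq_of_invariant`: the Killing orbit of a point of `M_ext` is eventually `≫`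
  any point of `M_ext`, `StationaryAFBlackHole.exists_orbit_mem_chronologicalFuture`);
* the far piece `e.far R₁` of the slice (an open submanifold) with the pulled-back data
  `ι^*(h, k)` (`InitialDataSet.comap`) and the end `{R₁ < ‖x‖}` (`inclusionAFEnd`) transported
  along the restricted chart `e.restrictChart` (`AFEnd.comap`): its chart components beyond `R₁`
  are those of `e` (`hCoeff_farEnd`, `kCoeff_farEnd`), so the decay class is unchanged
  (`isAsymptoticallyFlat_farEnd`); far regions are non-empty (`far_nonempty`).

References: P. T. Chruściel, J. L. Costa, Astérisque 321 (2008), §2.1–2.2 and §3 (Lemma 3.5);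
B. O'Neill (1983), Ch. 14, Cor. 14.1 and p. 403; Chruściel–Costa–Heusler, Living Rev. Relativity
15 (2012) 7, §2.4; R. Bartnik, CPAM 39 (1986), §1 and Def. 2.1; D. Christodoulou, S. Klainerman
(1993), (1.0.9).
-/

noncomputable section

-- `Summit.FinalStateConjecture.FinalStateConjecture.…`: summit = problem name (D-0017).
set_option linter.dupNamespace false

namespace Summit.FinalStateConjecture.FinalStateConjecture.Theorems.ZeroEnergyRigidity.GlobalHorizonKillingField.FuturePresentation

open Set Function Filter TopologicalSpace Bundle Literature.Geometry.Lorentzian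
open LorentzianMetric (subset_causalFuture chronologicalFuture_mono chronologicalPast_mono
  mem_chronologicalFuture_of_mem_chronologicalPast mem_chronologicalPast_of_mem_chronologicalFuture
  mem_causalPast_of_mem_causalFuture mem_chronologicalFuture_trans mem_chronologicalPast_trans
  mem_chronologicalFuture_of_mem_causalFuture isOpen_chronologicalFuture_of_boundaryless
  mem_chronologicalFuture_of_mem_chronologicalFuture_of_mem_causalFuture_set)
open scoped Manifold ContDiff Topology

/-! ## Push-up: chronological futures are closed under causal futures -/

section PushUp

variable {E : Type*} [NormedAddCommGroup E] [NormedSpace ℝ E] {H : Type*} [TopologicalSpace H]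
  {I : ModelWithCorners ℝ E H} {n : ℕ∞ω} {M : Type*} [TopologicalSpace M] [ChartedSpace H M]
  [IsManifold I ∞ M] [FiniteDimensional ℝ E] [BoundarylessManifold I M]
  {g : LorentzianMetric I n M} {τ : TimeOrientation g}

omit [FiniteDimensional ℝ E] [BoundarylessManifold I M] in
/-- Along a future causal curve on `[a, b]`, every point lies in the causal future of the initial
point. O'Neill 1983, Ch. 14, p. 402. [folklore] -/
theorem apply_mem_causalFuture_of_isFutureCausalCurveOn {γ : ℝ → M} {a b : ℝ}
    (hγ : g.IsFutureCausalCurveOn τ γ (Icc a b)) {t : ℝ} (ht : t ∈ Icc a b) :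
    γ t ∈ g.causalFuture τ {γ a} := by
  rcases eq_or_lt_of_le ht.1 with h | h
  · subst h
    exact subset_causalFuture g τ _ rfl
  · exact Or.inr ⟨γ a, rfl, γ, a, t, h, hγ.mono (Icc_subset_Icc_right ht.2), rfl, rfl⟩

/-- **No causal curve leaves `I⁺(S)`**: a future causal curve of `M` starting in `I⁺(S)` stays in
`I⁺(S)` (every later point is in the causal future of the initial one). O'Neill 1983, Ch. 14,
Cor. 14.1. [folklore] -/
theorem forall_mem_chronologicalFuture_of_isFutureCausalCurveOn (hn : 1 ≤ n) (S : Set M)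
    ⦃γ : ℝ → M⦄ ⦃a b : ℝ⦄ (_hab : a < b) (hγ : g.IsFutureCausalCurveOn τ γ (Icc a b))
    (ha : γ a ∈ g.chronologicalFuture τ S) : ∀ t ∈ Icc a b, γ t ∈ g.chronologicalFuture τ S :=
  fun _ ht ↦ mem_chronologicalFuture_of_mem_chronologicalFuture_of_mem_causalFuture_set hn ha
    (apply_mem_causalFuture_of_isFutureCausalCurveOn hγ ht)

omit [FiniteDimensional ℝ E] [BoundarylessManifold I M] in
/-- **`I⁺(A)` is preconnected when `A` is preconnected and `A ⊆ I⁺(A)`**: it is the union of the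
preconnected sets `A ∪ (a timelike segment from A)`, all containing `A`. Chruściel–Costa–Heusler
2012, §2.4 (the same argument for the d.o.c., `isPreconnected_docOfEnd`). [folklore] -/
theorem isPreconnected_chronologicalFuture {A : Set M}
    (hA : A ⊆ g.chronologicalFuture τ A) (hconn : IsPreconnected A) :
    IsPreconnected (g.chronologicalFuture τ A) := by
  rcases A.eq_empty_or_nonempty with hempty | ⟨x₀, hx₀⟩
  · have : g.chronologicalFuture τ A = ∅ := by
      ext p
      simp only [mem_empty_iff_false, iff_false]
      rintro ⟨m, hm, -⟩
      rw [hempty] at hm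
      exact hm
    rw [this]
    exact isPreconnected_empty
  let c : Set (Set M) :=
    {D | ∃ (γ : ℝ → M) (a b : ℝ), a < b ∧ g.IsFutureTimelikeCurveOn τ γ (Icc a b) ∧ γ a ∈ A ∧
      D = A ∪ γ '' Icc a b}
  have hsub : ∀ D ∈ c, D ⊆ g.chronologicalFuture τ A := by
    rintro D ⟨γ, a, b, hab, hγ, hγa, rfl⟩
    refine union_subset hA ?_
    rintro _ ⟨s, hs, rfl⟩
    rcases eq_or_lt_of_le hs.1 with h | h
    · subst h
      exact hA hγa
    · exact ⟨γ a, hγa, γ, a, s, h, hγ.mono (Icc_subset_Icc_right hs.2), rfl, rfl⟩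
  have hunion : g.chronologicalFuture τ A = ⋃₀ c := by
    refine Subset.antisymm (fun p hp ↦ ?_) (sUnion_subset hsub)
    obtain ⟨m, hm, γ, a, b, hab, hγ, hγa, hγb⟩ := hp
    exact mem_sUnion.2 ⟨A ∪ γ '' Icc a b, ⟨γ, a, b, hab, hγ, hγa ▸ hm, rfl⟩,
      Or.inr ⟨b, ⟨hab.le, le_rfl⟩, hγb⟩⟩
  rw [hunion]
  refine isPreconnected_sUnion x₀ c (fun D ⟨γ, a, b, _, _, _, hD⟩ ↦ hD ▸ Or.inl hx₀)
    (fun D ⟨γ, a, b, hab, hγ, hγa, hD⟩ ↦ ?_)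
  rw [hD]
  have hcont : ContinuousOn γ (Icc a b) := fun s hs ↦
    (hγ.isFutureCausalCurveOn.continuousAt hs).continuousWithinAt
  exact hconn.union (γ a) hγa ⟨a, ⟨le_rfl, hab.le⟩, rfl⟩ ((isPreconnected_Icc).image γ hcont)

end PushUp

/-! ## The future `I⁺(M_ext)` of the asymptotic region of a presentation -/

section FutureOfMext

variable (𝓑 : StationaryAFBlackHole.{0}) [𝓑.metric.HasLeviCivita]

omit [𝓑.metric.HasLeviCivita] in
/-- **`I⁺(M_ext)` is open** (O'Neill's Lemma 14.3 on the boundaryless carrier). O'Neill 1983,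
Ch. 14, Lemma 14.3. [folklore] -/
theorem isOpen_chronologicalFuture_Mext :
    IsOpen (𝓑.metric.chronologicalFuture 𝓑.timeOrientation 𝓑.Mext) :=
  isOpen_chronologicalFuture_of_boundaryless 𝓑.metric 𝓑.timeOrientation 𝓑.Mext

omit [𝓑.metric.HasLeviCivita] in
/-- **No causal curve leaves `I⁺(M_ext)`** (push-up). O'Neill 1983, Ch. 14, Cor. 14.1. [folklore] -/
theorem forall_mem_chronologicalFuture_Mext ⦃γ : ℝ → 𝓑.carrier⦄ ⦃a b : ℝ⦄ (hab : a < b)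
    (hγ : 𝓑.metric.IsFutureCausalCurveOn 𝓑.timeOrientation γ (Icc a b))
    (ha : γ a ∈ 𝓑.metric.chronologicalFuture 𝓑.timeOrientation 𝓑.Mext) :
    ∀ t ∈ Icc a b, γ t ∈ 𝓑.metric.chronologicalFuture 𝓑.timeOrientation 𝓑.Mext :=
  forall_mem_chronologicalFuture_of_isFutureCausalCurveOn (WithTop.coe_le_coe.mpr le_top) 𝓑.Mext hab
    hγ ha

/-- **`I⁺(M_ext)` is invariant under the stationary flow**: an integral curve of `T` starting in
`I⁺(M_ext)` stays in it (`φₜ(I⁺(M_ext)) = I⁺(M_ext)`, `exists_stationary_flow`). Chruściel–Costa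
2008, §2.2 and Lemma 3.6. [folklore] -/
theorem mem_chronologicalFuture_Mext_of_isMIntegralCurve {γ : ℝ → 𝓑.carrier}
    (hγ : IsMIntegralCurve γ 𝓑.killing)
    (h0 : γ 0 ∈ 𝓑.metric.chronologicalFuture 𝓑.timeOrientation 𝓑.Mext) (t : ℝ) :
    γ t ∈ 𝓑.metric.chronologicalFuture 𝓑.timeOrientation 𝓑.Mext := by
  obtain ⟨θ, hθ, hθ0, -, hθX, -, -, -, hF, -⟩ := 𝓑.exists_stationary_flow
  have hK1 : ContMDiff (𝓡 4) (𝓡 4).tangent 1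
      (fun x ↦ (⟨x, 𝓑.killing x⟩ : TangentBundle (𝓡 4) 𝓑.carrier)) :=
    𝓑.isStationaryKilling.isKillingField.contMDiff.of_le (WithTop.coe_le_coe.mpr le_top)
  rw [eq_flow_of_isMIntegralCurve hK1 hθX hθ0 hγ t, ← hF t]
  exact mem_image_of_mem _ h0

/-- **`I⁺(M_ext)` is connected**: `M_ext` is connected and `M_ext ⊆ I⁺(M_ext)`
(`isPreconnected_chronologicalFuture`). Chruściel–Costa 2008, §2.2. [folklore] -/
theorem isConnected_chronologicalFuture_Mext :
    IsConnected (𝓑.metric.chronologicalFuture 𝓑.timeOrientation 𝓑.Mext) :=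
  ⟨𝓑.Mext_nonempty.mono 𝓑.Mext_subset_chronologicalFuture,
    isPreconnected_chronologicalFuture 𝓑.Mext_subset_chronologicalFuture
      𝓑.isConnected_Mext.isPreconnected⟩

/-- **`I^±` of a non-empty flow-invariant part of `M_ext` are `I^±(M_ext)`, future half**: if
`∅ ≠ M₂ ⊆ M_ext` is invariant under the stationary flow then `I⁺(M₂) = I⁺(M_ext)` — every point of
`M_ext` is `≫` some point of the orbit of any point of `M_ext`
(`exists_orbit_mem_chronologicalFuture`, the flow preserving `≪`). Chruściel–Costa 2008, §3
(proof of Lemma 3.5) and §4.2. [folklore] -/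
theorem chronologicalFuture_eq_of_invariant {M₂ : Set 𝓑.carrier} (hsub : M₂ ⊆ 𝓑.Mext)
    (hne : M₂.Nonempty)
    (hinv : ∀ δ : ℝ → 𝓑.carrier, IsMIntegralCurve δ 𝓑.killing → δ 0 ∈ M₂ → ∀ s, δ s ∈ M₂) :
    𝓑.metric.chronologicalFuture 𝓑.timeOrientation M₂ =
      𝓑.metric.chronologicalFuture 𝓑.timeOrientation 𝓑.Mext := by
  refine Subset.antisymm (chronologicalFuture_mono hsub) ?_
  obtain ⟨p, hp⟩ := hne
  obtain ⟨θ, hθ, hθ0, hθadd, hθX, -⟩ := 𝓑.exists_stationary_flow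
  have hK : 𝓑.metric.IsKillingField 𝓑.killing := 𝓑.isStationaryKilling.isKillingField
  have hθ2 : ContMDiff (𝓘(ℝ, ℝ).prod (𝓡 4)) (𝓡 4) 2 θ := hθ.of_le (WithTop.coe_le_coe.mpr le_top)
  -- `M_ext ⊆ I⁺(M₂)`
  have hMext : 𝓑.Mext ⊆ 𝓑.metric.chronologicalFuture 𝓑.timeOrientation M₂ := by
    intro q hq
    obtain ⟨T, hT⟩ := StationaryAFBlackHole.exists_orbit_mem_chronologicalFuture (hsub hp) hq
      (hθX q) (hθ0 q)
    -- `q = φ_{-T}(φ_T(q)) ∈ φ_{-T}(I⁺(p)) = I⁺(φ_{-T}(p))`, and `φ_{-T}(p) ∈ M₂`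
    have h1 : q ∈ (fun r ↦ θ (-T, r)) '' 𝓑.metric.chronologicalFuture 𝓑.timeOrientation {p} :=
      ⟨θ (T, q), hT T le_rfl, flow_neg_apply_flow hθ0 hθadd T q⟩
    rw [hK.image_flow_chronologicalFuture hθ2 hθ0 hθadd hθX (-T) {p}, image_singleton] at h1
    exact chronologicalFuture_mono
      (singleton_subset_iff.2 (hinv (fun t ↦ θ (t, p)) (hθX p) (by rw [hθ0]; exact hp) (-T)))
      h1
  intro r hr
  rw [LorentzianMetric.chronologicalFuture_eq_biUnion] at hr
  simp only [mem_iUnion, exists_prop] at hr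
  obtain ⟨q, hq, hrq⟩ := hr
  exact mem_chronologicalFuture_trans (hMext hq) hrq

/-- **`I^±` of a non-empty flow-invariant part of `M_ext` are `I^±(M_ext)`, past half**:
`I⁻(M₂) = I⁻(M_ext)` (the orbit of a point of `M₂` eventually enters `I⁺(q)` for every `q ∈ M_ext`,
and stays in `M₂`). Chruściel–Costa 2008, §3 (proof of Lemma 3.5). [folklore] -/
theorem chronologicalPast_eq_of_invariant {M₂ : Set 𝓑.carrier} (hsub : M₂ ⊆ 𝓑.Mext)
    (hne : M₂.Nonempty)
    (hinv : ∀ δ : ℝ → 𝓑.carrier, IsMIntegralCurve δ 𝓑.killing → δ 0 ∈ M₂ → ∀ s, δ s ∈ M₂) :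
    𝓑.metric.chronologicalPast 𝓑.timeOrientation M₂ =
      𝓑.metric.chronologicalPast 𝓑.timeOrientation 𝓑.Mext := by
  refine Subset.antisymm (chronologicalPast_mono hsub) ?_
  obtain ⟨p, hp⟩ := hne
  obtain ⟨θ, -, hθ0, -, hθX, -⟩ := 𝓑.exists_stationary_flow
  -- `M_ext ⊆ I⁻(M₂)`
  have hMext : 𝓑.Mext ⊆ 𝓑.metric.chronologicalPast 𝓑.timeOrientation M₂ := by
    intro q hq
    obtain ⟨T, hT⟩ := StationaryAFBlackHole.exists_orbit_mem_chronologicalFuture hq (hsub hp)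
      (hθX p) (hθ0 p)
    exact chronologicalPast_mono
      (singleton_subset_iff.2 (hinv (fun t ↦ θ (t, p)) (hθX p) (by rw [hθ0]; exact hp) T))
      (mem_chronologicalPast_of_mem_chronologicalFuture (hT T le_rfl))
  intro r hr
  have hr' : r ∈ 𝓑.metric.chronologicalFuture 𝓑.timeOrientation.reverse 𝓑.Mext := hr
  rw [LorentzianMetric.chronologicalFuture_eq_biUnion] at hr'
  simp only [mem_iUnion, exists_prop] at hr'
  obtain ⟨q, hq, hrq⟩ := hr'
  exact mem_chronologicalPast_trans (hMext hq) hrq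

/-- **Registered sub-goal `stub_futurePresentation_invariantChronology`** (helper of stub S1b
`stub_futurePresentation`, crux `stmt-FinalStateConjecture-10690`): a non-empty flow-invariant
part `M₂` of `M_ext` has the same chronological future and past as `M_ext`
(`chronologicalFuture_eq_of_invariant`, `chronologicalPast_eq_of_invariant`). Chruściel–Costa 2008,
§3 (proof of Lemma 3.5). [folklore] -/
theorem stub_futurePresentation_invariantChronology :
    ∀ (𝓑 : StationaryAFBlackHole.{0}) [𝓑.metric.HasLeviCivita] (M₂ : Set 𝓑.carrier),
      M₂ ⊆ 𝓑.Mext → M₂.Nonempty →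
      (∀ δ : ℝ → 𝓑.carrier, IsMIntegralCurve δ 𝓑.killing → δ 0 ∈ M₂ → ∀ s, δ s ∈ M₂) →
        𝓑.metric.chronologicalFuture 𝓑.timeOrientation M₂ =
            𝓑.metric.chronologicalFuture 𝓑.timeOrientation 𝓑.Mext ∧
          𝓑.metric.chronologicalPast 𝓑.timeOrientation M₂ =
            𝓑.metric.chronologicalPast 𝓑.timeOrientation 𝓑.Mext :=
  fun 𝓑 _ _ hsub hne hinv ↦
    ⟨chronologicalFuture_eq_of_invariant 𝓑 hsub hne hinv,
      chronologicalPast_eq_of_invariant 𝓑 hsub hne hinv⟩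

end FutureOfMext

/-! ## The asymptotically flat end of the far piece `Σ_ext' = e.far (R + 1)` of the slice -/

section FarEnd

variable {X : Type} [TopologicalSpace X] [ChartedSpace E3 X]

/-- Every far region `{r < ‖x‖}` of an end is non-empty (the end is a copy of `{R < ‖x‖} ⊆ ℝ³`).
Bartnik 1986, §1. [folklore] -/
theorem far_nonempty (f : AFEnd X) (r : ℝ) : (f.far r).Nonempty := by
  set t : ℝ := |r| + f.R + 1 with ht
  have ht0 : 0 < t := by have := f.R_pos; positivity
  set z : E3 := t • EuclideanSpace.single (0 : Fin 3) (1 : ℝ) with hz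
  have hzn : ‖z‖ = t := by
    rw [hz, norm_smul, Real.norm_of_nonneg ht0.le]
    simp
  have hzR : z ∈ exteriorRegion f.R := by
    rw [mem_exteriorRegion, hzn, ht]
    linarith [abs_nonneg r]
  refine ⟨((f.chart.symm ⟨z, hzR⟩ : f.U) : X), f.chart.symm ⟨z, hzR⟩, ?_, rfl⟩
  show r < ‖((f.chart (f.chart.symm ⟨z, hzR⟩) : exteriorRegion f.R) : E3)‖
  rw [Diffeomorph.apply_symm_apply]
  show r < ‖z‖
  rw [hzn, ht]
  linarith [le_abs_self r, f.R_pos]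

variable [IsManifold (𝓡 3) ∞ X] (e : AFEnd X) (D : InitialDataSet (𝓡 3) X) {R₁ : ℝ}
  (hR₁ : e.R ≤ R₁)

omit [IsManifold (𝓡 3) ∞ X] in
/-- The inverse chart of the end `{R₁ < ‖x‖}` transported to the open submanifold `far R₁` of the
slice, followed by the inclusion, is the inverse chart of the end restricted to radius `R₁`
(all by construction). Bartnik 1986, §1. [folklore] -/
theorem val_comp_dataChart_farEnd :
    Subtype.val ∘ ((inclusionAFEnd (exteriorRegion R₁) R₁ (e.R_pos.trans_le hR₁)
      (fun _ h ↦ h)).comap (e.restrictChart hR₁)).dataChart = (e.restrict hR₁).dataChart :=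
  rfl

/-- **The chart components of `h` for the far piece are those of `e` beyond `R₁`**: the data
`(Σ_ext', ι^* h, ι^* k)` on the open submanifold `far R₁`, with the end `{R₁ < ‖x‖}` transported
along the restricted chart, are read through the same inverse chart as `(X, h, k)` with the end
restricted to radius `R₁` (chain rule for pullbacks). Bartnik 1986, §1, (1.3). [folklore] -/
theorem hCoeff_farEnd {z : E3} (hz : R₁ < ‖z‖) :
    AFEnd.hCoeff ((inclusionAFEnd (exteriorRegion R₁) R₁ (e.R_pos.trans_le hR₁)
        (fun _ h ↦ h)).comap (e.restrictChart hR₁))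
      (D.comap (Subtype.val : e.farOpens R₁ → X) (InitialDataSet.contMDiff_subtypeVal_succ _)
        (InitialDataSet.injective_mfderiv_subtypeVal _)) z = AFEnd.hCoeff e D z := by
  set e' := (inclusionAFEnd (exteriorRegion R₁) R₁ (e.R_pos.trans_le hR₁)
    (fun _ h ↦ h)).comap (e.restrictChart hR₁) with he'
  have hz' : e'.R < ‖z‖ := hz
  rw [AFEnd.hCoeff_of_lt _ hz', ← e.hCoeff_restrict D hR₁ hz,
    AFEnd.hCoeff_of_lt _ (show (e.restrict hR₁).R < ‖z‖ from hz)]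
  change pullbackBilin (I := 𝓡 3) (I' := 𝓡 3) e'.dataChart
      (pullbackBilin (I := 𝓡 3) (I' := 𝓡 3) (Subtype.val : e.farOpens R₁ → X) D.h.inner) ⟨z, hz'⟩ =
    _
  rw [← pullbackBilin_comp ((contMDiff_subtype_val (n := ∞)).mdifferentiable (by simp))
    (e'.contMDiff_dataChart.mdifferentiable (by simp))]
  rfl

/-- **The chart components of `k` for the far piece are those of `e` beyond `R₁`.**
Christodoulou–Klainerman 1993, (1.0.9). [folklore] -/
theorem kCoeff_farEnd {z : E3} (hz : R₁ < ‖z‖) :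
    AFEnd.kCoeff ((inclusionAFEnd (exteriorRegion R₁) R₁ (e.R_pos.trans_le hR₁)
        (fun _ h ↦ h)).comap (e.restrictChart hR₁))
      (D.comap (Subtype.val : e.farOpens R₁ → X) (InitialDataSet.contMDiff_subtypeVal_succ _)
        (InitialDataSet.injective_mfderiv_subtypeVal _)) z = AFEnd.kCoeff e D z := by
  set e' := (inclusionAFEnd (exteriorRegion R₁) R₁ (e.R_pos.trans_le hR₁)
    (fun _ h ↦ h)).comap (e.restrictChart hR₁) with he'
  have hz' : e'.R < ‖z‖ := hz
  rw [AFEnd.kCoeff_of_lt _ hz', ← e.kCoeff_restrict D hR₁ hz,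
    AFEnd.kCoeff_of_lt _ (show (e.restrict hR₁).R < ‖z‖ from hz)]
  change pullbackBilin (I := 𝓡 3) (I' := 𝓡 3) e'.dataChart
      (pullbackBilin (I := 𝓡 3) (I' := 𝓡 3) (Subtype.val : e.farOpens R₁ → X) D.k) ⟨z, hz'⟩ = _
  rw [← pullbackBilin_comp ((contMDiff_subtype_val (n := ∞)).mdifferentiable (by simp))
    (e'.contMDiff_dataChart.mdifferentiable (by simp))]
  rfl

/-- **The far piece of an asymptotically flat slice is asymptotically flat of the same order**:
the decay conditions `h - δ = O₂(r^{-α})`, `k = O₁(r^{-α-1})` only involve the chart components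
beyond any radius, where those of the far piece agree with those of `e` (`hCoeff_farEnd`,
`kCoeff_farEnd`; all derivatives agree on the open set `{R₁ < ‖x‖}`). Bartnik 1986, §1 and
Def. 2.1; Chruściel–Costa 2008, §2.1. [folklore] -/
theorem isAsymptoticallyFlat_farEnd {α : ℝ} (hAF : e.IsAsymptoticallyFlat D α) :
    ((inclusionAFEnd (exteriorRegion R₁) R₁ (e.R_pos.trans_le hR₁)
        (fun _ h ↦ h)).comap (e.restrictChart hR₁)).IsAsymptoticallyFlat
      (D.comap (Subtype.val : e.farOpens R₁ → X) (InitialDataSet.contMDiff_subtypeVal_succ _)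
        (InitialDataSet.injective_mfderiv_subtypeVal _)) α := by
  set e' := (inclusionAFEnd (exteriorRegion R₁) R₁ (e.R_pos.trans_le hR₁)
    (fun _ h ↦ h)).comap (e.restrictChart hR₁) with he'
  set D' := D.comap (Subtype.val : e.farOpens R₁ → X) (InitialDataSet.contMDiff_subtypeVal_succ _)
    (InitialDataSet.injective_mfderiv_subtypeVal _) with hD'
  have hS : IsOpen {w : E3 | R₁ < ‖w‖} := isOpen_lt continuous_const continuous_norm
  have hh : ∀ z : E3, R₁ < ‖z‖ →
      (fun y ↦ AFEnd.hCoeff e' D' y - (innerSL ℝ : E3 →L[ℝ] E3 →L[ℝ] ℝ)) =ᶠ[𝓝 z]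
        fun y ↦ AFEnd.hCoeff e D y - (innerSL ℝ : E3 →L[ℝ] E3 →L[ℝ] ℝ) := by
    intro z hz
    filter_upwards [hS.mem_nhds hz] with w hw
    rw [he', hD', hCoeff_farEnd e D hR₁ hw]
  have hk : ∀ z : E3, R₁ < ‖z‖ → AFEnd.kCoeff e' D' =ᶠ[𝓝 z] AFEnd.kCoeff e D := by
    intro z hz
    filter_upwards [hS.mem_nhds hz] with w hw
    rw [he', hD', kCoeff_farEnd e D hR₁ hw]
  have hev : ∀ᶠ z in Bornology.cobounded E3, R₁ < ‖z‖ := by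
    filter_upwards [eventually_cobounded_le_norm (E := E3) (R₁ + 1)] with z hz
    linarith
  refine ⟨fun m hm ↦ (hAF.1 m hm).congr' ?_ EventuallyEq.rfl,
    fun m hm ↦ (hAF.2 m hm).congr' ?_ EventuallyEq.rfl⟩
  · filter_upwards [hev] with z hz
    rw [((hh z hz).iteratedFDeriv ℝ m).eq_of_nhds]
  · filter_upwards [hev] with z hz
    rw [((hk z hz).iteratedFDeriv ℝ m).eq_of_nhds]

end FarEnd

end Summit.FinalStateConjecture.FinalStateConjecture.Theorems.ZeroEnergyRigidity.GlobalHorizonKillingField.FuturePresentation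

end
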